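import Summits.HodgeConjecture.HodgeConjecture.Theorems.TropicalWeilObstructionTropicalWeilVanishingBoundaryCalibrated
import Summits.HodgeConjecture.HodgeConjecture.Theorems.TropicalWeilObstructionTropicalWeilVanishingFrameSpanRank
import Literature.AlgebraicGeometry.HodgeTheory.ComplexTorusHodgeNumbers
import HarnessLib

/-!
# Route `TropicalWeilObstruction` (Kontsevich's tropical test — NEGATION SINK, exploration, no summit claim):
# the boundary of the calibration cone — II. the hyperplane reading: calibrated ⟺ frames in a hyperplane of `⋀⁴ℝ⁸`

Negation-sink bookkeeping of the cell `pub-hodge-tropical` (seat tropical-1 gen 8); part II of the BOUNDARY series. Tropical-1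
gen 6's direction bound (`FrameSpan.restricted_annihilator_eq_zero_of_offBoundary`, p340981) says that OFF the cone boundary the
restricted Plücker vectors `(p_σ(I_r))_{r<70}` of an effective tropical `4`-cycle with class `q₀θ₄(Q) + q₁Re w(Q) + q₂Im w(Q)`,
`q₀ ≠ 0`, span `ℝ⁷⁰`. Here the converse:

* `strictMono_wordOfRank`, `wordOfRank_injective`, `wordOfRank_bijective` (decided) and `sum_wordOfRank_det_mul_det` — Cauchy–Binet
  ON THE 70 INCREASING WORDS `I_r = Chk.wordOfRank r` (from the tree's `det_mul_eq_sum_strictMono` and `card_strictMono_eq_choose`);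
  `sum_wordOfRank_dz_mul_pluckerCoord`: `Σ_r dz(I_r) p_L(I_r) = η(L)`;
* `exists_restricted_annihilator_of_boundary` — **ON THE BOUNDARY THE FRAMES LIE IN A HYPERPLANE**: `c_r = Re(ζ dz(I_r)) ≠ 0` is
  orthogonal to every restricted Plücker vector (part I's collinear phase `ζ`); `exists_restricted_annihilator_iff_boundary`,
  `span_restrictedFrames_eq_top_iff_offBoundary` — the dichotomy with p340981;
* `finrank_span_restrictedFrames_le_of_boundary` (`≤ 69`), `finrank_span_restrictedFrames_ge` (`≥ 69` at a very general period,
  tropical-1 gen 6's test vector), `finrank_span_restrictedFrames_eq` — for a NON-EMPTY effective cycle at a very general Weil period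
  the restricted frame span has dimension EXACTLY `69` on the boundary and `70` off it.

HONEST STATUS. A size statement about an OPEN problem; decides nothing about K1 or the Hodge conjecture. No definition, no named
fact, no sorry. References: [Zharkov2020TropicalWeil] I. Zharkov, arXiv:2002.02347, §2 (pp. 2–4); [MikhalkinZharkov2014Eigenwave]
G. Mikhalkin, I. Zharkov, LN UMI 15 (2014), Prop. 4.3, Thm. 5.4; Cauchy–Binet [folklore].
-/

set_option linter.dupNamespace false

noncomputable section

open scoped BigOperators
open Matrix
open Literature.AlgebraicGeometry.Tropical
open Summit.HodgeConjecture.HodgeConjecture.Theorems.TropicalHodgeBound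

namespace Summit.HodgeConjecture.HodgeConjecture.Theorems.TropicalWeilVanishing.Boundary

/-! ## §0 Display-only notation (the K3 skeleton's local definitions, verbatim bodies; nothing is defined) -/

/-- The skeleton's `dzCoord n S`. -/
local notation3 (prettyPrint := false) "dz⟦" n "⟧" S:max =>
  (Matrix.det (Matrix.of fun k a : Fin n =>
    (if (S a : ℕ) = (k : ℕ) then (1 : ℂ) else 0) + (if (S a : ℕ) = (k : ℕ) + n then Complex.I else 0)))

/-- The skeleton's `thetaClass n Q`. -/
local notation3 (prettyPrint := false) "θ⟦" n "⟧" Q:max =>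
  (fun S S' : Fin n → Fin (2 * n) => Matrix.det (Matrix.submatrix Q S S'))

/-- The skeleton's `omegaFrame n` (`Ω = Pᴴ`). -/
local notation3 (prettyPrint := false) "Ω⟦" n "⟧" =>
  (Matrix.of fun (a : Fin (2 * n)) (b : Fin n) =>
    (if (a : ℕ) = (b : ℕ) then (1 : ℂ) else 0) - (if (a : ℕ) = (b : ℕ) + n then Complex.I else 0))

/-- The skeleton's `weilClassC n Q` (`w(Q) = (⋀ⁿQ ⊗ 1)(Ω ⊗ Ω)`). -/
local notation3 (prettyPrint := false) "wC⟦" n "⟧" Q:max =>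
  (fun S S' : Fin n → Fin (2 * n) =>
    Matrix.det (Matrix.submatrix (Matrix.map Q ((↑) : ℝ → ℂ) * Ω⟦n⟧) S id) *
      Matrix.det (Matrix.submatrix (Ω⟦n⟧) S' id))

/-- The skeleton's `weilClassRe n Q` (`w₁ = Re w`). -/
local notation3 (prettyPrint := false) "wRe⟦" n "⟧" Q:max =>
  (fun S S' : Fin n → Fin (2 * n) => Complex.re ((wC⟦n⟧ Q) S S'))

/-- The skeleton's `weilClassIm n Q` (`w₂ = Im w`). -/
local notation3 (prettyPrint := false) "wIm⟦" n "⟧" Q:max =>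
  (fun S S' : Fin n → Fin (2 * n) => Complex.im ((wC⟦n⟧ Q) S S'))

/-- The `Ω`-minor `Ω(S) := det Ω⟦4⟧[S,·]` of a word `S`. -/
local notation3 (prettyPrint := false) "Ωm" S:max => (Matrix.det (Matrix.submatrix (Ω⟦4⟧) S id))

/-! ## §1 The 70 increasing words and Cauchy–Binet on them -/

/-- The tabulated words `I_r = Chk.wordOfRank r`, `r < 70`, are strictly increasing (decided). [folklore] -/
theorem strictMono_wordOfRank (r : Fin 70) : StrictMono (Chk.wordOfRank r) := by
  rw [Fin.strictMono_iff_lt_succ]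
  revert r
  decide

/-- The tabulated words are pairwise distinct (decided). [folklore] -/
theorem wordOfRank_injective : Function.Injective fun r : Fin 70 => Chk.wordOfRank r := by
  intro r s h
  have key : ∀ r s : Fin 70, Chk.wordOfRank r 0 = Chk.wordOfRank s 0 → Chk.wordOfRank r 1 = Chk.wordOfRank s 1 →
      Chk.wordOfRank r 2 = Chk.wordOfRank s 2 → Chk.wordOfRank r 3 = Chk.wordOfRank s 3 → r = s := by
    decide +kernel
  exact key r s (congrFun h 0) (congrFun h 1) (congrFun h 2) (congrFun h 3)

/-- `r ↦ I_r` is a bijection from `Fin 70` onto the strictly increasing words `Fin 4 → Fin 8` (`C(8,4) = 70`). [folklore] -/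
theorem wordOfRank_bijective :
    Function.Bijective fun r : Fin 70 => (⟨Chk.wordOfRank r, strictMono_wordOfRank r⟩ :
      {w : Fin 4 → Fin (2 * 4) // StrictMono w}) := by
  rw [Fintype.bijective_iff_injective_and_card]
  refine ⟨fun r s h => wordOfRank_injective (congrArg Subtype.val h), ?_⟩
  rw [Literature.AlgebraicGeometry.HodgeTheory.card_strictMono_eq_choose, Fintype.card_fin, Fintype.card_fin]
  decide +kernel

/-- **Cauchy–Binet on the increasing words.** For `A : 4 × 8` and `B : 8 × 4` over a commutative ring,
`Σ_{r<70} det A[·, I_r] · det B[I_r, ·] = det (A B)`. [folklore] -/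
theorem sum_wordOfRank_det_mul_det {R : Type*} [CommRing R] (A : Matrix (Fin 4) (Fin (2 * 4)) R)
    (B : Matrix (Fin (2 * 4)) (Fin 4) R) :
    ∑ r : Fin 70, (A.submatrix id (Chk.wordOfRank r)).det * (B.submatrix (Chk.wordOfRank r) id).det = (A * B).det := by
  classical
  rw [Literature.Analysis.TotalPositivity.det_mul_eq_sum_strictMono A B]
  have h1 : ∑ t ∈ (Finset.univ : Finset (Fin 4 → Fin (2 * 4))).filter (fun t => StrictMono t),
      (A.submatrix id t).det * (B.submatrix t id).det =
      ∑ w : {w : Fin 4 → Fin (2 * 4) // StrictMono w}, (A.submatrix id w.1).det * (B.submatrix w.1 id).det :=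
    Finset.sum_subtype _ (fun w => by simp) (fun t => (A.submatrix id t).det * (B.submatrix t id).det)
  rw [h1]
  exact (Fintype.sum_bijective _ wordOfRank_bijective _ _ fun r => rfl)

/-- **`Σ_{r<70} dz(I_r) · p_L(I_r) = η(L)`**: Cauchy–Binet on increasing words for one frame (`dz(S) = det P[·,S]`,
`η(L) = det (P L)`). [cite: MikhalkinZharkov2014Eigenwave, Prop. 4.3] -/
theorem sum_wordOfRank_dz_mul_pluckerCoord (L : Matrix (Fin (2 * 4)) (Fin 4) ℤ) :
    ∑ r : Fin 70, dz⟦4⟧ (Chk.wordOfRank r) * ((pluckerCoord L (Chk.wordOfRank r) : ℤ) : ℂ) =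
      frameComplexDet 4 L := by
  rw [frameComplexDet_eq_det, ← sum_wordOfRank_det_mul_det]
  refine Finset.sum_congr rfl fun r _ => ?_
  rw [dz_eq_det_submatrix, pluckerCoord, intCast_det, Matrix.submatrix_map]

variable (Q : Matrix (Fin (2 * 4)) (Fin (2 * 4)) ℝ)

/-! ## §4 The hyperplane reading: on the boundary the Plücker vectors of the cells lie in a hyperplane of `⋀⁴ℝ⁸` -/

/-- Some increasing word has `Ω`-minor `-i` (decided; the word `(0,1,2,7)`). [folklore] -/
theorem exists_omegaMinorF_wordOfRank_eq_negI : ∃ r : Fin 70, Chk.omegaMinorF (Chk.wordOfRank r) = ⟨0, -1⟩ := by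
  decide +kernel

/-- Some increasing word has `Ω`-minor `-i`, in `ℂ`. [folklore] -/
theorem exists_omega_wordOfRank_eq_negI : ∃ r : Fin 70, Ωm (Chk.wordOfRank r) = -Complex.I := by
  obtain ⟨r, hr⟩ := exists_omegaMinorF_wordOfRank_eq_negI
  refine ⟨r, ?_⟩
  rw [← omegaMinorF_toComplex, hr]
  apply Complex.ext <;> simp

/-- The pairing with the lifted test vector on increasing words: `Σ_r p_L(I_r) · Re(ζ dz(I_r)) = Re(ζ η(L))`
(Cauchy–Binet on the increasing words). [cite: MikhalkinZharkov2014Eigenwave, Prop. 4.3] -/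
theorem sum_pluckerCoord_mul_re_dz (ζ : ℂ) (L : Matrix (Fin (2 * 4)) (Fin 4) ℤ) :
    ∑ r : Fin 70, ((pluckerCoord L (Chk.wordOfRank r) : ℤ) : ℝ) * (ζ * dz⟦4⟧ (Chk.wordOfRank r)).re =
      (ζ * frameComplexDet 4 L).re := by
  rw [← sum_wordOfRank_dz_mul_pluckerCoord, Finset.mul_sum, Complex.re_sum]
  refine Finset.sum_congr rfl fun r _ => ?_
  rw [show ζ * (dz⟦4⟧ (Chk.wordOfRank r) * ((pluckerCoord L (Chk.wordOfRank r) : ℤ) : ℂ)) =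
    (((pluckerCoord L (Chk.wordOfRank r) : ℤ) : ℝ) : ℂ) * (ζ * dz⟦4⟧ (Chk.wordOfRank r)) by push_cast; ring,
    Complex.re_ofReal_mul]

/-- **ON THE CONE BOUNDARY THE FRAMES LIE IN A HYPERPLANE.** For `Q ≻ 0` commuting with `J` and an effective tropical
`4`-cycle `Z` whose class `q₀ θ₄(Q) + q₁ Re w(Q) + q₂ Im w(Q)` is on the boundary `64(q₁² + q₂²) = q₀²`, there is a NON-ZERO
`c ∈ ℝ⁷⁰` orthogonal to all restricted Plücker vectors `(p_σ(I_r))_{r<70}`: namely `c_r = Re(ζ dz(I_r))` with the phase `ζ`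
of `exists_collinear_of_boundary`. The converse of `FrameSpan.restricted_annihilator_eq_zero_of_offBoundary` (p340981).
[cite: Zharkov2020TropicalWeil, §2] [cite: MikhalkinZharkov2014Eigenwave, Prop. 4.3 and Thm. 5.4] -/
theorem exists_restricted_annihilator_of_boundary (hQ : Q.PosDef) (hJ : Q * weilJ 4 = weilJ 4 * Q)
    (Z : TropicalTorusCycle (2 * 4) 4 Q) {q₀ q₁ q₂ : ℝ}
    (hq : Z.cyc = q₀ • θ⟦4⟧ Q + q₁ • wRe⟦4⟧ Q + q₂ • wIm⟦4⟧ Q) (hbd : 64 * (q₁ ^ 2 + q₂ ^ 2) = q₀ ^ 2) :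
    ∃ c : Fin 70 → ℝ, c ≠ 0 ∧
      ∀ σ, ∑ r : Fin 70, ((pluckerCoord (Z.cell σ).frame (Chk.wordOfRank r) : ℤ) : ℝ) * c r = 0 := by
  obtain ⟨ζ, hζ, hcol⟩ := exists_collinear_of_boundary Q hQ hJ Z hq hbd
  refine ⟨fun r => (ζ * dz⟦4⟧ (Chk.wordOfRank r)).re, ?_, fun σ => ?_⟩
  · intro hc
    obtain ⟨r₁, hr₁⟩ := FrameSpan.exists_omega_wordOfRank_eq_one
    obtain ⟨r₂, hr₂⟩ := exists_omega_wordOfRank_eq_negI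
    have e1 := congrFun hc r₁
    have e2 := congrFun hc r₂
    simp only [Pi.zero_apply] at e1 e2
    rw [← conj_omegaMinor_eq_dz, hr₁, map_one, mul_one] at e1
    rw [← conj_omegaMinor_eq_dz, hr₂, map_neg, Complex.conj_I, neg_neg, Complex.mul_I_re, neg_eq_zero] at e2
    exact hζ (Complex.ext e1 e2)
  · rw [sum_pluckerCoord_mul_re_dz, hcol σ]

/-- **HYPERPLANE ⟺ BOUNDARY** (`Q ≻ 0`, `QJ = JQ`, a representation with `q₀ ≠ 0` — e.g. any NON-EMPTY effective cycle at a
Weil-generic period, where `q₀ > 0`): a non-zero vector of `ℝ⁷⁰` orthogonal to all restricted Plücker vectors of `Z` exists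
iff the class is on the boundary of the calibration cone (⟸ above; ⟹ is tropical-1 gen 6's
`FrameSpan.restricted_annihilator_eq_zero_of_offBoundary`). [cite: Zharkov2020TropicalWeil, §2]
[cite: MikhalkinZharkov2014Eigenwave, Prop. 4.3 and Thm. 5.4] -/
theorem exists_restricted_annihilator_iff_boundary (hQ : Q.PosDef) (hJ : Q * weilJ 4 = weilJ 4 * Q)
    (Z : TropicalTorusCycle (2 * 4) 4 Q) {q₀ q₁ q₂ : ℝ}
    (hq : Z.cyc = q₀ • θ⟦4⟧ Q + q₁ • wRe⟦4⟧ Q + q₂ • wIm⟦4⟧ Q) (hq0 : q₀ ≠ 0) :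
    (∃ c : Fin 70 → ℝ, c ≠ 0 ∧
      ∀ σ, ∑ r : Fin 70, ((pluckerCoord (Z.cell σ).frame (Chk.wordOfRank r) : ℤ) : ℝ) * c r = 0) ↔
      64 * (q₁ ^ 2 + q₂ ^ 2) = q₀ ^ 2 := by
  refine ⟨fun ⟨c, hc, hann⟩ => ?_, fun hbd => exists_restricted_annihilator_of_boundary Q hQ hJ Z hq hbd⟩
  by_contra hoff
  exact hc (FrameSpan.restricted_annihilator_eq_zero_of_offBoundary hQ.det_pos.ne'.isUnit hJ Z q₀ q₁ q₂ hq hq0 hoff c hann)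

/-- The dot-product functional `v ↦ Σ_r v_r c_r` on `ℝ⁷⁰`. [folklore] -/
theorem exists_dotFunctional (c : Fin 70 → ℝ) :
    ∃ φ : (Fin 70 → ℝ) →ₗ[ℝ] ℝ, ∀ v, φ v = ∑ r, v r * c r :=
  ⟨{ toFun := fun v => ∑ r, v r * c r
     map_add' := fun v w => by simp only [Pi.add_apply, add_mul, Finset.sum_add_distrib]
     map_smul' := fun a v => by
       simp only [Pi.smul_apply, smul_eq_mul, RingHom.id_apply, Finset.mul_sum]
       exact Finset.sum_congr rfl fun r _ => by ring }, fun v => rfl⟩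

/-- A vector orthogonal to a spanning family of `ℝ⁷⁰` is zero. [folklore] -/
theorem eq_zero_of_orthogonal_of_span_eq_top {ι : Type*} (u : ι → Fin 70 → ℝ)
    (htop : Submodule.span ℝ (Set.range u) = ⊤) (c : Fin 70 → ℝ) (h : ∀ i, ∑ r, u i r * c r = 0) : c = 0 := by
  obtain ⟨φ, hφ⟩ := exists_dotFunctional c
  have hle : Submodule.span ℝ (Set.range u) ≤ LinearMap.ker φ := by
    rw [Submodule.span_le]
    rintro _ ⟨i, rfl⟩
    rw [SetLike.mem_coe, LinearMap.mem_ker, hφ]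
    exact h i
  rw [htop, top_le_iff] at hle
  have hc : φ c = 0 := LinearMap.mem_ker.mp (hle ▸ Submodule.mem_top)
  rw [hφ] at hc
  funext r
  have hsum : ∑ r, c r * c r = 0 := hc
  exact mul_self_eq_zero.mp (le_antisymm
    ((Finset.sum_eq_zero_iff_of_nonneg fun r _ => mul_self_nonneg (c r)).mp hsum r (Finset.mem_univ r)).le
    (mul_self_nonneg _))

/-- **THE RESTRICTED FRAMES SPAN `ℝ⁷⁰` ⟺ OFF THE BOUNDARY** (`Q ≻ 0`, `QJ = JQ`, representation with `q₀ ≠ 0`).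
[cite: Zharkov2020TropicalWeil, §2] [cite: MikhalkinZharkov2014Eigenwave, Prop. 4.3 and Thm. 5.4] -/
theorem span_restrictedFrames_eq_top_iff_offBoundary (hQ : Q.PosDef) (hJ : Q * weilJ 4 = weilJ 4 * Q)
    (Z : TropicalTorusCycle (2 * 4) 4 Q) {q₀ q₁ q₂ : ℝ}
    (hq : Z.cyc = q₀ • θ⟦4⟧ Q + q₁ • wRe⟦4⟧ Q + q₂ • wIm⟦4⟧ Q) (hq0 : q₀ ≠ 0) :
    Submodule.span ℝ (Set.range fun σ : Fin Z.numCells => fun r : Fin 70 =>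
      ((pluckerCoord (Z.cell σ).frame (Chk.wordOfRank r) : ℤ) : ℝ)) = ⊤ ↔ 64 * (q₁ ^ 2 + q₂ ^ 2) ≠ q₀ ^ 2 := by
  refine ⟨fun htop hbd => ?_,
    FrameSpan.span_restrictedFrames_eq_top_of_offBoundary hQ.det_pos.ne'.isUnit hJ Z q₀ q₁ q₂ hq hq0⟩
  obtain ⟨c, hc, hann⟩ := exists_restricted_annihilator_of_boundary Q hQ hJ Z hq hbd
  exact hc (eq_zero_of_orthogonal_of_span_eq_top _ htop c hann)

/-- On the boundary the restricted frame span has dimension `≤ 69` (it lies in the kernel of a non-zero functional on `ℝ⁷⁰`).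
[cite: Zharkov2020TropicalWeil, §2] [cite: MikhalkinZharkov2014Eigenwave, Prop. 4.3 and Thm. 5.4] -/
theorem finrank_span_restrictedFrames_le_of_boundary (hQ : Q.PosDef) (hJ : Q * weilJ 4 = weilJ 4 * Q)
    (Z : TropicalTorusCycle (2 * 4) 4 Q) {q₀ q₁ q₂ : ℝ}
    (hq : Z.cyc = q₀ • θ⟦4⟧ Q + q₁ • wRe⟦4⟧ Q + q₂ • wIm⟦4⟧ Q) (hbd : 64 * (q₁ ^ 2 + q₂ ^ 2) = q₀ ^ 2) :
    Module.finrank ℝ (Submodule.span ℝ (Set.range fun σ : Fin Z.numCells => fun r : Fin 70 =>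
      ((pluckerCoord (Z.cell σ).frame (Chk.wordOfRank r) : ℤ) : ℝ))) ≤ 69 := by
  obtain ⟨c, hc, hann⟩ := exists_restricted_annihilator_of_boundary Q hQ hJ Z hq hbd
  obtain ⟨φ, hφ⟩ := exists_dotFunctional c
  have hle : Submodule.span ℝ (Set.range fun σ : Fin Z.numCells => fun r : Fin 70 =>
      ((pluckerCoord (Z.cell σ).frame (Chk.wordOfRank r) : ℤ) : ℝ)) ≤ LinearMap.ker φ := by
    rw [Submodule.span_le]
    rintro _ ⟨σ, rfl⟩
    rw [SetLike.mem_coe, LinearMap.mem_ker, hφ]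
    exact hann σ
  have hφc : φ c ≠ 0 := by
    rw [hφ]
    intro h0
    apply hc
    funext r
    exact mul_self_eq_zero.mp (le_antisymm
      ((Finset.sum_eq_zero_iff_of_nonneg fun r _ => mul_self_nonneg (c r)).mp h0 r (Finset.mem_univ r)).le
      (mul_self_nonneg _))
  have hrange : Module.finrank ℝ (LinearMap.range φ) = 1 := by
    have h1 : LinearMap.range φ = ⊤ := by
      rw [eq_top_iff]
      intro x _
      refine ⟨(x / φ c) • c, ?_⟩
      rw [map_smul, smul_eq_mul, div_mul_cancel₀ x hφc]
    rw [h1, finrank_top, Module.finrank_self]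
  have hker : Module.finrank ℝ (LinearMap.ker φ) = 69 := by
    have h := LinearMap.finrank_range_add_finrank_ker φ
    rw [hrange, Module.finrank_fin_fun] at h
    omega
  exact (Submodule.finrank_mono hle).trans hker.le

/-- At a very general Weil period the restricted frame span of a NON-EMPTY effective cycle has dimension `≥ 69` (the annihilator is
at most a line: tropical-1 gen 6's `FrameSpan.exists_testVector`). [cite: Zharkov2020TropicalWeil, §2] -/
theorem finrank_span_restrictedFrames_ge (hQ : Q.PosDef) (hJ : Q * weilJ 4 = weilJ 4 * Q) (hgen : IsWeilGeneric 4 Q)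
    (Z : TropicalTorusCycle (2 * 4) 4 Q) (hZ : 0 < Z.numCells) :
    69 ≤ Module.finrank ℝ (Submodule.span ℝ (Set.range fun σ : Fin Z.numCells => fun r : Fin 70 =>
      ((pluckerCoord (Z.cell σ).frame (Chk.wordOfRank r) : ℤ) : ℝ))) := by
  classical
  obtain ⟨v, hv⟩ := FrameSpan.exists_testVector Q hQ hJ hgen Z hZ
  set R : Set (Fin 70 → ℝ) := Set.range fun σ : Fin Z.numCells => fun r : Fin 70 =>
      ((pluckerCoord (Z.cell σ).frame (Chk.wordOfRank r) : ℤ) : ℝ) with hR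
  have htop : Submodule.span ℝ (insert v R) = ⊤ := by
    refine FrameSpan.span_insert_eq_top_of_testVector R v fun c hc hvc => hv c (fun σ => ?_) hvc
    exact hc _ (Set.mem_range_self σ)
  have h70 : Module.finrank ℝ (Fin 70 → ℝ) = 70 := Module.finrank_fin_fun ℝ
  have h1 : 70 ≤ Module.finrank ℝ (Submodule.span ℝ ({v} : Set (Fin 70 → ℝ))) + Module.finrank ℝ (Submodule.span ℝ R) := by
    have h := Submodule.finrank_add_le_finrank_add_finrank (Submodule.span ℝ ({v} : Set (Fin 70 → ℝ))) (Submodule.span ℝ R)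
    rw [← Submodule.span_union, Set.singleton_union, htop, finrank_top, h70] at h
    exact h
  have h2 : Module.finrank ℝ (Submodule.span ℝ ({v} : Set (Fin 70 → ℝ))) ≤ 1 := by
    simpa using finrank_span_le_card ({v} : Set (Fin 70 → ℝ))
  omega

/-- **RESTRICTED FRAME SPAN EXACTLY `69` ⟺ BOUNDARY, `70` ⟺ OFF THE BOUNDARY** for a NON-EMPTY effective tropical `4`-cycle at a
very general Weil period, given its class `q₀ θ₄(Q) + q₁ Re w(Q) + q₂ Im w(Q)` (K3). [cite: Zharkov2020TropicalWeil, §2]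
[cite: MikhalkinZharkov2014Eigenwave, Prop. 4.3 and Thm. 5.4] -/
theorem finrank_span_restrictedFrames_eq (hQ : Q.PosDef) (hJ : Q * weilJ 4 = weilJ 4 * Q) (hgen : IsWeilGeneric 4 Q)
    (Z : TropicalTorusCycle (2 * 4) 4 Q) (hZ : 0 < Z.numCells) {q₀ q₁ q₂ : ℝ}
    (hq : Z.cyc = q₀ • θ⟦4⟧ Q + q₁ • wRe⟦4⟧ Q + q₂ • wIm⟦4⟧ Q) :
    Module.finrank ℝ (Submodule.span ℝ (Set.range fun σ : Fin Z.numCells => fun r : Fin 70 =>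
      ((pluckerCoord (Z.cell σ).frame (Chk.wordOfRank r) : ℤ) : ℝ))) = if 64 * (q₁ ^ 2 + q₂ ^ 2) = q₀ ^ 2 then 69 else 70 := by
  have hq0 : q₀ ≠ 0 := FrameSpan.thetaCoeff_ne_zero_of_repr hQ.det_pos.ne'.isUnit hJ Z hZ q₀ q₁ q₂ hq
  have hge := finrank_span_restrictedFrames_ge Q hQ hJ hgen Z hZ
  split_ifs with hbd
  · exact le_antisymm (finrank_span_restrictedFrames_le_of_boundary Q hQ hJ Z hq hbd) hge
  · have htop := FrameSpan.span_restrictedFrames_eq_top_of_offBoundary hQ.det_pos.ne'.isUnit hJ Z q₀ q₁ q₂ hq hq0 hbd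
    rw [htop, finrank_top, Module.finrank_fin_fun]

end Summit.HodgeConjecture.HodgeConjecture.Theorems.TropicalWeilVanishing.Boundary

end
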